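import Literature.AlgebraicGeometry.ShimuraVarieties.KudlaRapoport2013.Sec9LocalCharacterHilbertSymbol
import Literature.AlgebraicGeometry.ShimuraVarieties.KudlaRapoport2013.Sec14TraceDualHolds
import Mathlib.RingTheory.Localization.AsSubring
import Mathlib.RingTheory.DedekindDomain.Dvr
import Mathlib.LinearAlgebra.FreeModule.PID
import Mathlib.RingTheory.Localization.Module
import HarnessLib

/-!
# [KudlaRapoport2013, §9 after (9.2) (arXiv v2 p. 33)] «since `V` contains a self dual lattice, an inert place `p` lies in `Diff(T, V)` iff
# `ord_p(det T)` is odd» — DISCHARGED: `KR2013_9_diff_inert_iff_diff0_holds`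

Kernel-lane companion of the statement carpet ★ `Literature/AlgebraicGeometry/ShimuraVarieties/KudlaRapoport2013/Sec7to10EisensteinSide.lean`:
its CLOSED named fact ★ `KR2013_9_diff_inert_iff_diff0` is PROVED here, together with its lattice-theoretic input ★ `isLocalNormAt_det_of_isSelfDualFor`
(at an inert `p`, the determinant of a hermitian space containing a self-dual `O_k`-lattice is a local norm: `χ_p(det V) = 1`).  THEOREMS ONLY (no
definition, no named fact, no `sorry`, no instance, no notation); cell hodgecm-mathlib, seat B-typ01 (g32); net debt −1.  The local-character inputs
(`χ_p = ( · , Δ)_p`, `χ_p = (−1)^{ord_p}` at inert `p`) are ★ `Sec9LocalCharacterHilbertSymbol.lean`.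

## The argument (KR p. 33, implicit; O'Meara §82F for the local structure)

Let `p` be inert, `𝔭 = p O_k` (a prime), `O' = (O_k)_𝔭 ⊆ k` the local ring (a DVR: Mathlib
`IsLocalization.AtPrime.isDiscreteValuationRing_of_dedekind_domain`, realised inside `k` by `Localization.subalgebra.ofField`), and
`M = O'·L ⊆ kⁿ`.  `M` is finitely generated and torsion-free over the PID `O'`, hence free (Mathlib `Module.free_of_finite_type_torsion_free'`)
on a basis `e₁, …, e_n` which is a `k`-basis of `kⁿ` (`LinearIndependent.iff_fractionRing`).  Self-duality of `L` localises: `M = {x ∣ (x, M) ⊆ O'}`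
(clearing denominators, Mathlib `IsLocalization.exist_integer_multiples_of_finset`), so the Gram matrix `G = (e_j, e_i)` lies in `GL_n(O')` (its
inverse expresses the dual basis, which lies in `M`).  With `g` the matrix of the `e_i`: `det G = det g · σ(det g) · det J`, where `det G ∈ O'^× ∩ ℚ` has
`ord_p = 0` and `det g · σ(det g) = N_{k/ℚ}(det g)` is a local norm; hence `ord_p(det J)` is even, i.e. `χ_p(det J) = 1` by ★
`isLocalNormAt_iff_even_padicValRat` (O'Meara 63:16).

## References
* [KudlaRapoport2013] S. Kudla, M. Rapoport, *Special cycles on unitary Shimura varieties II: global theory*, §9 (9.2) (arXiv v2 p. 33).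
* [Omeara1963] O. T. O'Meara, *Introduction to quadratic forms* (1963), §82F (unimodular lattices), §63C Example 63:16.
-/

set_option autoImplicit false

noncomputable section

open NumberField IsDedekindDomain Module
open Literature.NumberTheory.Automorphic.Liu2021.AppendixC (conj conj_ne_one conj_apply complexEmbedding_conj)
open Literature.AlgebraicGeometry.ShimuraVarieties.KudlaRapoport2013.Sec2Defs (IsInertPrime sigmaInt)
open Literature.AlgebraicGeometry.ShimuraVarieties.KudlaRapoport2013.Sec3ComplexUniformization
  (krForm IsHermitianFor IsFullLattice IsSelfDualFor)
open Literature.AlgebraicGeometry.ShimuraVarieties.KudlaRapoport2013.Sec14CaseNTwo (KR14dual.mul_conj_eq_norm)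
open scoped TensorProduct Matrix nonZeroDivisors

namespace Literature.AlgebraicGeometry.ShimuraVarieties.KudlaRapoport2013.Sec7to10EisensteinSide

variable (k : Type) [Field k] [NumberField k] [IsTotallyComplex k] [Algebra.IsQuadraticExtension ℚ k]

/-! ### `σ` on `O_k` and the prime `𝔭 = p O_k` -/

/-- `σ(σ x) = x`. [folklore] -/
private theorem conj_conj' (x : k) : conj ℚ k (conj ℚ k x) = x := by
  letI : IsCMField k := IsCMField.ofCMExtension ℚ k
  exact IsCMField.complexConj_apply_apply (K := k) x

/-- `sigmaInt` is `σ` on `O_k`. [folklore] -/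
private theorem coe_sigmaInt (a : 𝓞 k) : ((sigmaInt k a : 𝓞 k) : k) = conj ℚ k a := rfl

variable {k} in
/-- `σ(𝔭) ⊆ 𝔭` for `𝔭 = p O_k`: `s ∉ 𝔭 ⟹ σ(s) ∉ 𝔭`. [folklore] -/
private theorem sigmaInt_notMem_span {p : ℕ} {s : 𝓞 k} (hs : s ∉ Ideal.span {(p : 𝓞 k)}) :
    sigmaInt k s ∉ Ideal.span {(p : 𝓞 k)} := by
  intro h
  apply hs
  rw [Ideal.mem_span_singleton] at h ⊢
  obtain ⟨t, ht⟩ := h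
  refine ⟨sigmaInt k t, ?_⟩
  have h2 := congrArg (sigmaInt k) ht
  rw [map_mul, map_natCast] at h2
  rw [← h2]
  apply RingOfIntegers.ext
  rw [coe_sigmaInt, coe_sigmaInt, conj_conj']

/-- An element fixed by `σ` is rational. [folklore] -/
private theorem exists_rat_eq_of_conj_eq' {x : k} (hx : conj ℚ k x = x) : ∃ q : ℚ, algebraMap ℚ k q = x := by
  letI : IsCMField k := IsCMField.ofCMExtension ℚ k
  have hx' : IsCMField.complexConj k x = x := hx
  have hmem : x ∈ maximalRealSubfield k := (IsCMField.complexConj_eq_self_iff (K := k) x).1 hx'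
  exact ⟨(CMExtension.equivMaximalRealSubfield ℚ k).symm ⟨x, hmem⟩, by
    rw [CMExtension.algebraMap_equivMaximalRealSubfield_symm_apply]; rfl⟩

variable {k} in
/-- **`p ∤ N(s)` for `s ∈ O_k ∖ 𝔭`**, `𝔭 = pO_k` prime: `N(s) = s σ(s) ∈ 𝔭` would force `s ∈ 𝔭` or `σ(s) ∈ 𝔭`. [folklore] -/
private theorem not_dvd_norm_of_notMem {p : ℕ} (h𝔭 : (Ideal.span {(p : 𝓞 k)}).IsPrime) {s : 𝓞 k}
    (hs : s ∉ Ideal.span {(p : 𝓞 k)}) : ¬ (p : ℤ) ∣ Algebra.norm ℤ s := by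
  rintro ⟨t, ht⟩
  have hnorm : (s : k) * conj ℚ k s = ((Algebra.norm ℤ s : ℤ) : k) := by
    rw [KR14dual.mul_conj_eq_norm (s : k), ← Algebra.coe_norm_int s, eq_ratCast, Rat.cast_intCast]
  have hmem : s * sigmaInt k s ∈ Ideal.span {(p : 𝓞 k)} := by
    rw [Ideal.mem_span_singleton]
    refine ⟨(t : 𝓞 k), RingOfIntegers.ext ?_⟩
    simp only [map_mul, map_natCast, map_intCast]
    rw [← RingOfIntegers.coe_eq_algebraMap, ← RingOfIntegers.coe_eq_algebraMap, coe_sigmaInt, hnorm, ht]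
    push_cast
    ring
  rcases h𝔭.mem_or_mem hmem with h | h
  · exact hs h
  · exact sigmaInt_notMem_span hs h

/-! ### The hermitian pairing `(x, y) = σ(y)ᵀ J x` (★ `krForm`): sesquilinearity -/

section KrForm

variable {k}
variable {n : ℕ} (J : Matrix (Fin n) (Fin n) k)

/-- Additivity of `(x, y)` in `x`. [folklore] -/
private theorem krForm_add_left (x x' y : Fin n → k) :
    krForm (conj ℚ k : k →+* k) J (x + x') y = krForm (conj ℚ k : k →+* k) J x y + krForm (conj ℚ k : k →+* k) J x' y := by
  simp [krForm, Matrix.mulVec_add, dotProduct_add]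

/-- `k`-linearity of `(x, y)` in `x`. [folklore] -/
private theorem krForm_smul_left (c : k) (x y : Fin n → k) :
    krForm (conj ℚ k : k →+* k) J (c • x) y = c * krForm (conj ℚ k : k →+* k) J x y := by
  simp [krForm, Matrix.mulVec_smul, dotProduct_smul]

/-- `(0, y) = 0`. [folklore] -/
private theorem krForm_zero_left (y : Fin n → k) : krForm (conj ℚ k : k →+* k) J 0 y = 0 := by
  simp [krForm]

/-- Additivity of `(x, y)` in `y`. [folklore] -/
private theorem krForm_add_right (x y y' : Fin n → k) :
    krForm (conj ℚ k : k →+* k) J x (y + y') = krForm (conj ℚ k : k →+* k) J x y + krForm (conj ℚ k : k →+* k) J x y' := by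
  have h : (⇑(conj ℚ k : k →+* k) ∘ (y + y')) = (⇑(conj ℚ k : k →+* k) ∘ y) + (⇑(conj ℚ k : k →+* k) ∘ y') := by
    funext i; simp
  rw [krForm, krForm, krForm, h, add_dotProduct]

/-- `σ`-antilinearity of `(x, y)` in `y`. [folklore] -/
private theorem krForm_smul_right (c : k) (x y : Fin n → k) :
    krForm (conj ℚ k : k →+* k) J x (c • y) = conj ℚ k c * krForm (conj ℚ k : k →+* k) J x y := by
  have h : (⇑(conj ℚ k : k →+* k) ∘ (c • y)) = conj ℚ k c • (⇑(conj ℚ k : k →+* k) ∘ y) := by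
    funext i; simp
  rw [krForm, krForm, h, smul_dotProduct, smul_eq_mul]

/-- `(x, 0) = 0`. [folklore] -/
private theorem krForm_zero_right (x : Fin n → k) : krForm (conj ℚ k : k →+* k) J x 0 = 0 := by
  have h : (⇑(conj ℚ k : k →+* k) ∘ (0 : Fin n → k)) = 0 := by funext i; simp
  rw [krForm, h, zero_dotProduct]

/-- Finite sums in the first variable. [folklore] -/
private theorem krForm_sum_left {ι : Type*} (s : Finset ι) (x : ι → Fin n → k) (y : Fin n → k) :
    krForm (conj ℚ k : k →+* k) J (∑ i ∈ s, x i) y = ∑ i ∈ s, krForm (conj ℚ k : k →+* k) J (x i) y := by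
  classical
  induction s using Finset.induction_on with
  | empty => simp [krForm_zero_left]
  | insert a s ha ih => rw [Finset.sum_insert ha, Finset.sum_insert ha, krForm_add_left, ih]

/-- Finite sums in the second variable. [folklore] -/
private theorem krForm_sum_right {ι : Type*} (s : Finset ι) (x : Fin n → k) (y : ι → Fin n → k) :
    krForm (conj ℚ k : k →+* k) J x (∑ i ∈ s, y i) = ∑ i ∈ s, krForm (conj ℚ k : k →+* k) J x (y i) := by
  classical
  induction s using Finset.induction_on with
  | empty => simp [krForm_zero_right]
  | insert a s ha ih => rw [Finset.sum_insert ha, Finset.sum_insert ha, krForm_add_right, ih]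

/-- `(e_j, e_i)` as a matrix product: the Gram matrix of a family `e` is `ᵗ(σ g) J g` for the matrix `g` with columns `e_i`. [folklore] -/
private theorem krForm_eq_mul_apply (e : Fin n → Fin n → k) (i j : Fin n) :
    krForm (conj ℚ k : k →+* k) J (e j) (e i) =
      (((Matrix.of fun a l => e l a).map (conj ℚ k : k →+* k))ᵀ * J * Matrix.of fun a l => e l a) i j := by
  simp only [krForm, dotProduct, Matrix.mulVec, Function.comp_apply, Matrix.mul_apply, Matrix.transpose_apply,
    Matrix.map_apply, Matrix.of_apply, Finset.sum_mul, Finset.mul_sum]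
  rw [Finset.sum_comm]
  refine Finset.sum_congr rfl fun a _ => Finset.sum_congr rfl fun b _ => ?_
  ring

end KrForm

/-! ### The localized lattice `M = O'·L` over a `σ`-stable principal subring `O' ⊆ k` with denominators -/

section Localized

variable {k}
variable {n : ℕ} {J : Matrix (Fin n) (Fin n) k} {L : Submodule (𝓞 k) (Fin n → k)}
variable (O' : Subalgebra (𝓞 k) k)

omit [NumberField k] [IsTotallyComplex k] [Algebra.IsQuadraticExtension ℚ k] in
/-- `O_k ⊆ O'`, as a statement about the range of `O_k → k`. [folklore] -/
private theorem range_le (x : k) (hx : x ∈ (algebraMap (𝓞 k) k).range) : x ∈ O' := by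
  obtain ⟨a, rfl⟩ := hx
  exact O'.algebraMap_mem a

/-- The values of the pairing on `M = O'·L` lie in `O'` when `L` is integral (`(L, L) ⊆ O_k`) and `σ(O') ⊆ O'`. [folklore] -/
private theorem krForm_mem_of_mem_span (hσ : ∀ x ∈ O', conj ℚ k x ∈ O')
    (hLL : ∀ x ∈ L, ∀ y ∈ L, krForm (conj ℚ k : k →+* k) J x y ∈ (algebraMap (𝓞 k) k).range)
    {F : Set (Fin n → k)} (hF : F ⊆ L) {x y : Fin n → k}
    (hx : x ∈ Submodule.span O' F) (hy : y ∈ Submodule.span O' F) :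
    krForm (conj ℚ k : k →+* k) J x y ∈ O' := by
  induction hx, hy using Submodule.span_induction₂ with
  | mem_mem x y hx hy => exact range_le O' _ (hLL x (hF hx) y (hF hy))
  | zero_left y hy => rw [krForm_zero_left]; exact zero_mem _
  | zero_right x hx => rw [krForm_zero_right]; exact zero_mem _
  | add_left x y z hx hy hz h1 h2 => rw [krForm_add_left]; exact add_mem h1 h2
  | add_right x y z hx hy hz h1 h2 => rw [krForm_add_right]; exact add_mem h1 h2
  | smul_left r x y hx hy h => rw [Subalgebra.smul_def, krForm_smul_left]; exact mul_mem r.2 h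
  | smul_right r x y hx hy h => rw [Subalgebra.smul_def, krForm_smul_right]; exact mul_mem (hσ _ r.2) h

/-- **Self-duality localises**: if `L` is self-dual, `F ⊆ L` a finite generating set, and `O'` admits common denominators
(`hden`), then every `x ∈ kⁿ` with `(x, y) ∈ O'` for all `y ∈ F` lies in `M = O'·F`. [folklore] -/
private theorem mem_span_of_forall_krForm_mem
    (hden : ∀ T : Finset k, (∀ t ∈ T, t ∈ O') →
      ∃ s : 𝓞 k, (s : k) ≠ 0 ∧ ((s : k))⁻¹ ∈ O' ∧ ∀ t ∈ T, (s : k) * t ∈ (algebraMap (𝓞 k) k).range)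
    (hLd : IsSelfDualFor (conj ℚ k : k →+* k) J L) {F : Finset (Fin n → k)}
    (hFL : Submodule.span (𝓞 k) (F : Set (Fin n → k)) = L) {x : Fin n → k}
    (hx : ∀ y ∈ F, krForm (conj ℚ k : k →+* k) J x y ∈ O') :
    x ∈ Submodule.span O' (F : Set (Fin n → k)) := by
  classical
  obtain ⟨s, hs0, hsO, hs⟩ := hden (F.image fun y => krForm (conj ℚ k : k →+* k) J x y)
    (by intro t ht; obtain ⟨y, hy, rfl⟩ := Finset.mem_image.1 ht; exact hx y hy)
  -- `(s x, y) ∈ O_k` for all `y ∈ L`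
  have hsx : ∀ y ∈ L, krForm (conj ℚ k : k →+* k) J ((s : k) • x) y ∈ (algebraMap (𝓞 k) k).range := by
    intro y hy
    rw [← hFL] at hy
    induction hy using Submodule.span_induction with
    | mem y hy =>
        rw [krForm_smul_left]
        exact hs _ (Finset.mem_image_of_mem _ hy)
    | zero => rw [krForm_zero_right]; exact zero_mem _
    | add y z hy hz h1 h2 => rw [krForm_add_right]; exact add_mem h1 h2
    | smul a y hy h =>
        rw [show a • y = ((a : k)) • y from rfl, krForm_smul_right]
        exact mul_mem ⟨sigmaInt k a, rfl⟩ h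
  have hsxL : (s : k) • x ∈ L := (hLd ((s : k) • x)).2 hsx
  have hmem : (s : k) • x ∈ Submodule.span O' (F : Set (Fin n → k)) := by
    have h := Submodule.span_le_restrictScalars (𝓞 k) O' (F : Set (Fin n → k))
    rw [hFL] at h
    exact h hsxL
  have hx' : x = (⟨((s : k))⁻¹, hsO⟩ : O') • ((s : k) • x) := by
    rw [Subalgebra.smul_def, smul_smul]
    change x = (((s : k))⁻¹ * (s : k)) • x
    rw [inv_mul_cancel₀ hs0, one_smul]
  rw [hx']
  exact Submodule.smul_mem _ _ hmem

/-- **Over a principal `σ`-stable subring with denominators, a self-dual integral lattice localises to a free lattice with UNIMODULAR Gram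
matrix**: there are `g ∈ GL_n(k)` (columns: an `O'`-basis of `O'·L`, a `k`-basis of `kⁿ`) and `G = ᵗ(σg) J g`, `C` with entries in `O'` and
`G C = 1`. [folklore] -/
private theorem exists_unimodular_gram [IsPrincipalIdealRing O'] (hσ : ∀ x ∈ O', conj ℚ k x ∈ O')
    (hden : ∀ T : Finset k, (∀ t ∈ T, t ∈ O') →
      ∃ s : 𝓞 k, (s : k) ≠ 0 ∧ ((s : k))⁻¹ ∈ O' ∧ ∀ t ∈ T, (s : k) * t ∈ (algebraMap (𝓞 k) k).range)
    (hL : IsFullLattice L) (hLd : IsSelfDualFor (conj ℚ k : k →+* k) J L) (hJ0 : J.det ≠ 0) :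
    ∃ g G C : Matrix (Fin n) (Fin n) k, g.det ≠ 0 ∧ G = (g.map (conj ℚ k : k →+* k))ᵀ * J * g ∧
      (∀ i j, G i j ∈ O') ∧ (∀ i j, C i j ∈ O') ∧ G * C = 1 := by
  classical
  obtain ⟨F, hFL⟩ := hL.1
  have hFsub : (F : Set (Fin n → k)) ⊆ L := hFL ▸ Submodule.subset_span
  have hLL : ∀ x ∈ L, ∀ y ∈ L, krForm (conj ℚ k : k →+* k) J x y ∈ (algebraMap (𝓞 k) k).range :=
    fun x hx y hy => (hLd x).1 hx y hy
  set M : Submodule O' (Fin n → k) := Submodule.span O' (F : Set (Fin n → k)) with hM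
  haveI : Module.Finite O' M := Module.Finite.span_of_finite O' F.finite_toSet
  haveI : Module.IsTorsionFree O' (Fin n → k) := Module.IsTorsionFree.of_smul_eq_zero fun c v h => by
    rw [Subalgebra.smul_def] at h
    rcases smul_eq_zero.1 h with h1 | h1
    · exact Or.inl (by exact_mod_cast h1)
    · exact Or.inr h1
  obtain ⟨m, b⟩ := Module.basisOfFiniteTypeTorsionFree' (R := O') (M := M)
  set e : Fin m → (Fin n → k) := fun i => (b i : Fin n → k) with he
  have hli : LinearIndependent k e := by
    have h1 : LinearIndependent O' e := b.linearIndependent.map' M.subtype (Submodule.ker_subtype M)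
    exact (LinearIndependent.iff_fractionRing O' k).1 h1
  have hmemM : ∀ x ∈ L, x ∈ M := fun x hx => by
    have h := Submodule.span_le_restrictScalars (𝓞 k) O' (F : Set (Fin n → k))
    rw [hFL] at h
    exact h hx
  have hrepr : ∀ (y : Fin n → k) (hy : y ∈ M), y = ∑ i, ((b.repr ⟨y, hy⟩ i : O') : k) • e i := by
    intro y hy
    have h2 := congrArg (fun z : M => (z : Fin n → k)) (b.sum_repr ⟨y, hy⟩)
    simp only [AddSubmonoidClass.coe_finsetSum, SetLike.val_smul, Subalgebra.smul_def] at h2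
    exact h2.symm
  have hsp : ⊤ ≤ Submodule.span k (Set.range e) := by
    rw [← hL.2]
    refine Submodule.span_le.2 fun x hx => ?_
    rw [hrepr x (hmemM x hx)]
    exact Submodule.sum_mem _ fun i _ => Submodule.smul_mem _ _ (Submodule.subset_span ⟨i, rfl⟩)
  let E : Basis (Fin m) k (Fin n → k) := Basis.mk hli hsp
  have hmn : m = n := by
    have h := Module.finrank_eq_card_basis E
    simpa using h.symm
  subst hmn
  -- the matrices
  set g : Matrix (Fin m) (Fin m) k := Matrix.of fun a l => e l a with hg
  set G : Matrix (Fin m) (Fin m) k := (g.map (conj ℚ k : k →+* k))ᵀ * J * g with hGdef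
  have hG : ∀ i j, G i j = krForm (conj ℚ k : k →+* k) J (e j) (e i) := fun i j =>
    (krForm_eq_mul_apply J e i j).symm
  have hgE : g = (Pi.basisFun k (Fin m)).toMatrix E := by
    ext a l
    rw [Basis.toMatrix_apply, Pi.basisFun_repr, Basis.coe_mk, hg, Matrix.of_apply]
  have hgdet : g.det ≠ 0 := by
    have h1 := (Pi.basisFun k (Fin m)).toMatrix_mul_toMatrix_flip E
    rw [← hgE] at h1
    intro h0
    have h2 := congrArg Matrix.det h1
    rw [Matrix.det_mul, h0, zero_mul, Matrix.det_one] at h2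
    exact zero_ne_one h2
  have hGmem : ∀ i j, G i j ∈ O' := fun i j => by
    rw [hG]
    exact krForm_mem_of_mem_span O' hσ hLL hFsub (b j).2 (b i).2
  have hGdet : G.det ≠ 0 := by
    rw [hGdef, Matrix.det_mul, Matrix.det_mul, Matrix.det_transpose, ← RingHom.mapMatrix_apply, ← RingHom.map_det]
    exact mul_ne_zero (mul_ne_zero ((map_ne_zero _).2 hgdet) hJ0) hgdet
  set C : Matrix (Fin m) (Fin m) k := G⁻¹ with hC
  have hGC : G * C = 1 := Matrix.mul_nonsing_inv G (isUnit_iff_ne_zero.2 hGdet)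
  -- the dual basis lies in `M`, so `C` has entries in `O'`
  have hCmem : ∀ j l, C j l ∈ O' := by
    intro j l
    set f : Fin m → k := ∑ j', C j' l • e j' with hf
    have hfe : ∀ i, krForm (conj ℚ k : k →+* k) J f (e i) = if i = l then 1 else 0 := by
      intro i
      have h1 := congrFun (congrFun hGC i) l
      rw [Matrix.mul_apply, Matrix.one_apply] at h1
      rw [hf, krForm_sum_left, ← h1]
      refine Finset.sum_congr rfl fun j' _ => ?_
      rw [krForm_smul_left, ← hG, mul_comm]
    have hfM : f ∈ M := by
      refine mem_span_of_forall_krForm_mem O' hden hLd hFL fun y hy => ?_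
      rw [hrepr y (hmemM y (hFsub hy)), krForm_sum_right]
      refine Subalgebra.sum_mem _ fun i _ => ?_
      rw [krForm_smul_right, hfe]
      refine mul_mem (hσ _ (b.repr _ i).2) ?_
      split_ifs
      · exact one_mem _
      · exact zero_mem _
    have h1 : (E.repr f : Fin m → k) = fun j' => C j' l := by
      have h := E.repr_sum_self (fun j' => C j' l)
      have hsum : (∑ i, (fun j' => C j' l) i • E i) = f := by
        rw [hf]
        exact Finset.sum_congr rfl fun i _ => by rw [Basis.coe_mk]
      rw [hsum] at h
      exact h
    have h2 : (E.repr f : Fin m → k) = fun j' => ((b.repr ⟨f, hfM⟩ j' : O') : k) := by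
      have h := E.repr_sum_self (fun j' => ((b.repr ⟨f, hfM⟩ j' : O') : k))
      have hsum : (∑ i, (fun j' => ((b.repr ⟨f, hfM⟩ j' : O') : k)) i • E i) = f := by
        calc (∑ i, (fun j' => ((b.repr ⟨f, hfM⟩ j' : O') : k)) i • E i)
            = ∑ i, ((b.repr ⟨f, hfM⟩ i : O') : k) • e i :=
              Finset.sum_congr rfl fun i _ => by rw [Basis.coe_mk]
          _ = f := (hrepr f hfM).symm
      rw [hsum] at h
      exact h
    have h3 : C j l = ((b.repr ⟨f, hfM⟩ j : O') : k) := by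
      have h := congrFun (h1.symm.trans h2) j
      simpa using h
    rw [h3]
    exact (b.repr ⟨f, hfM⟩ j).2
  exact ⟨g, G, C, hgdet, hGdef ▸ rfl, hGmem, hCmem, hGC⟩

end Localized

/-! ### The local ring `O' = (O_k)_𝔭 ⊆ k` at an inert `p` -/

section LocalRing

variable {k}

omit [IsTotallyComplex k] [Algebra.IsQuadraticExtension ℚ k] in
/-- Membership in Mathlib's `Localization.subalgebra.ofField`: `x = a/s` with `s ∈ S`. [folklore] -/
private theorem mem_ofField_iff {S : Submonoid (𝓞 k)} (hS : S ≤ (𝓞 k)⁰) (x : k) :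
    x ∈ Localization.subalgebra.ofField k S hS ↔ ∃ (a s : 𝓞 k) (_ : s ∈ S), x = (a : k) * ((s : k))⁻¹ := by
  rw [← SetLike.mem_coe, Localization.subalgebra.ofField, Subalgebra.coe_copy]
  rfl

/-- **`ℚ ∩ O'` consists of `p`-integral rationals**: if `q = a/s ∈ ℚ` with `a ∈ O_k`, `s ∈ O_k ∖ pO_k` (`p` inert), then
`q² N(s) = N(a) ∈ ℤ` with `p ∤ N(s)`, so `ord_p(q) ≥ 0`. [folklore] -/
private theorem padicValRat_nonneg_of_mem {p : ℕ} [hp : Fact p.Prime] (h𝔭 : (Ideal.span {(p : 𝓞 k)}).IsPrime) {q : ℚ} (hq : q ≠ 0)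
    {a s : 𝓞 k} (hs : s ∉ Ideal.span {(p : 𝓞 k)}) (hqas : algebraMap ℚ k q = (a : k) * ((s : k))⁻¹) :
    0 ≤ padicValRat p q := by
  have h2 : Module.finrank ℚ k = 2 := Algebra.IsQuadraticExtension.finrank_eq_two (R := ℚ) (S := k)
  have hs0 : (s : k) ≠ 0 := by
    intro h0
    apply hs
    have : s = 0 := RingOfIntegers.ext (by simpa using h0)
    rw [this]
    exact zero_mem _
  have hqs : algebraMap ℚ k q * (s : k) = (a : k) := by rw [hqas, inv_mul_cancel_right₀ hs0]
  have hnorm := congrArg (Algebra.norm ℚ) hqs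
  rw [map_mul, Algebra.norm_algebraMap, h2, ← Algebra.coe_norm_int s, ← Algebra.coe_norm_int a] at hnorm
  -- `hnorm : q ^ 2 * N(s) = N(a)` in `ℚ`
  have hNs0 : Algebra.norm ℤ s ≠ 0 := by
    rw [Ne, Algebra.norm_eq_zero_iff]
    intro h0; exact hs0 (by rw [h0]; rfl)
  have ha0 : (a : k) ≠ 0 := by rw [← hqs]; exact mul_ne_zero ((map_ne_zero _).2 hq) hs0
  have hNa0 : Algebra.norm ℤ a ≠ 0 := by
    rw [Ne, Algebra.norm_eq_zero_iff]
    intro h0; exact ha0 (by rw [h0]; rfl)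
  have hv := congrArg (padicValRat p) hnorm
  rw [padicValRat.mul (pow_ne_zero 2 hq) (by exact_mod_cast hNs0), padicValRat.pow, padicValRat.of_int, padicValRat.of_int,
    padicValInt.eq_zero_of_not_dvd (not_dvd_norm_of_notMem h𝔭 hs)] at hv
  push_cast at hv
  have h0 : (0 : ℤ) ≤ (padicValInt p (Algebra.norm ℤ a) : ℤ) := by positivity
  omega

/-- `N_{k/ℚ}(x)` is a local norm at every `p`: `(1 ⊗ x) · (1 ⊗ σ)(1 ⊗ x) = 1 ⊗ x σ(x) = N(x) ⊗ 1`. [folklore] -/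
private theorem isLocalNormAt_norm {p : ℕ} [Fact p.Prime] (x : k) : IsLocalNormAt k p (Algebra.norm ℚ x) := by
  refine ⟨(1 : ℚ_[p]) ⊗ₜ[ℚ] x, ?_⟩
  rw [Algebra.TensorProduct.map_tmul, AlgHom.id_apply, Algebra.TensorProduct.tmul_mul_tmul, mul_one,
    show ((conj ℚ k : k →ₐ[ℚ] k) x) = conj ℚ k x from rfl, KR14dual.mul_conj_eq_norm x,
    Algebra.algebraMap_eq_smul_one, Algebra.algebraMap_eq_smul_one, TensorProduct.tmul_smul, TensorProduct.smul_tmul']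

end LocalRing

/-! ### The theorem -/

/-- **[KR2013 §9, after (9.2)] «since `V` contains a self dual lattice» — at an inert prime the determinant of `V` is a local norm.**
For `J ∈ M_n(k)` with `det J ≠ 0` such that `V = (kⁿ, J)` contains a full self-dual `O_k`-lattice `L` (★ `IsFullLattice`, ★ `IsSelfDualFor`;
hermitian symmetry is not even needed), and `p` inert in `k`: `χ_p(det J) = 1` (★ `IsLocalNormAt`).  Over the DVR `O' = (O_k)_{(p)}` the lattice `O'·L` is free with
unimodular Gram matrix `G = ᵗ(σg) J g` (O'Meara §82F), so `det J = det G · N(det g)⁻¹` with `ord_p(det G) = 0` and `N(det g)` a norm, whence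
`ord_p(det J)` is even, i.e. `det J` is a norm from the unramified `k_p` (O'Meara 63:16). [cite: KudlaRapoport2013, §9 (9.2) (arXiv v2 p. 33)]
[cite: Omeara1963, §82F and §63C Example 63:16] -/
theorem isLocalNormAt_det_of_isSelfDualFor {n : ℕ} {J : Matrix (Fin n) (Fin n) k} {L : Submodule (𝓞 k) (Fin n → k)}
    (hJ0 : J.det ≠ 0) (hL : IsFullLattice L)
    (hLd : IsSelfDualFor (conj ℚ k : k →+* k) J L) {p : ℕ} [hp : Fact p.Prime] (hin : IsInertPrime k p)
    {dJ : ℚ} (hdJ : algebraMap ℚ k dJ = J.det) : IsLocalNormAt k p dJ := by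
  classical
  -- the local ring `O' = (O_k)_𝔭`, `𝔭 = pO_k` prime
  set 𝔭 : Ideal (𝓞 k) := Ideal.span {(p : 𝓞 k)} with h𝔭def
  haveI h𝔭 : 𝔭.IsPrime := hin.2.2
  have h𝔭0 : 𝔭 ≠ ⊥ := by
    rw [h𝔭def, Ne, Ideal.span_singleton_eq_bot]
    exact_mod_cast hp.out.ne_zero
  have hS : 𝔭.primeCompl ≤ (𝓞 k)⁰ := 𝔭.primeCompl_le_nonZeroDivisors
  set O' : Subalgebra (𝓞 k) k := Localization.subalgebra.ofField k 𝔭.primeCompl hS with hO'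
  haveI : IsLocalization.AtPrime O' 𝔭 := Localization.subalgebra.isLocalization_ofField k 𝔭.primeCompl hS
  haveI : IsDiscreteValuationRing O' := IsLocalization.AtPrime.isDiscreteValuationRing_of_dedekind_domain (𝓞 k) h𝔭0 O'
  -- its three properties
  have hσ : ∀ x ∈ O', conj ℚ k x ∈ O' := by
    intro x hx
    obtain ⟨a, s, hs, rfl⟩ := (mem_ofField_iff hS x).1 hx
    refine (mem_ofField_iff hS _).2 ⟨sigmaInt k a, sigmaInt k s, sigmaInt_notMem_span hs, ?_⟩
    rw [map_mul, map_inv₀, coe_sigmaInt, coe_sigmaInt]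
  have hden : ∀ T : Finset k, (∀ t ∈ T, t ∈ O') →
      ∃ s : 𝓞 k, (s : k) ≠ 0 ∧ ((s : k))⁻¹ ∈ O' ∧ ∀ t ∈ T, (s : k) * t ∈ (algebraMap (𝓞 k) k).range := by
    intro T hT
    let T' : Finset O' := T.attach.image fun t => ⟨t.1, hT t.1 t.2⟩
    obtain ⟨b, hb⟩ := IsLocalization.exist_integer_multiples_of_finset 𝔭.primeCompl T'
    have hb0 : ((b : 𝓞 k) : k) ≠ 0 := by
      intro h0
      apply b.2
      have : (b : 𝓞 k) = 0 := RingOfIntegers.ext (by simpa using h0)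
      change (b : 𝓞 k) ∈ 𝔭
      rw [this]; exact zero_mem _
    refine ⟨b, hb0, (mem_ofField_iff hS _).2 ⟨1, b, b.2, by simp⟩, fun t ht => ?_⟩
    have hmem : (⟨t, hT t ht⟩ : O') ∈ T' := Finset.mem_image.2 ⟨⟨t, ht⟩, Finset.mem_attach _ _, rfl⟩
    obtain ⟨c, hc⟩ := hb _ hmem
    refine ⟨c, ?_⟩
    have h := congrArg (fun z : O' => (z : k)) hc
    simpa [Algebra.smul_def] using h
  -- the unimodular Gram matrix
  obtain ⟨g, G, C, hgdet, hGdef, hGmem, hCmem, hGC⟩ := exists_unimodular_gram O' hσ hden hL hLd hJ0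
  -- determinants
  have hdetG : G.det = conj ℚ k g.det * J.det * g.det := by
    rw [hGdef, Matrix.det_mul, Matrix.det_mul, Matrix.det_transpose, ← RingHom.mapMatrix_apply, ← RingHom.map_det]
    rfl
  set ν : ℚ := Algebra.norm ℚ g.det with hν
  have hν0 : ν ≠ 0 := by rw [hν, Ne, Algebra.norm_eq_zero_iff]; exact hgdet
  have hdJ0 : dJ ≠ 0 := by rintro rfl; rw [map_zero] at hdJ; exact hJ0 hdJ.symm
  have hdetG' : G.det = algebraMap ℚ k (ν * dJ) := by
    rw [map_mul, hdJ, hν, ← KR14dual.mul_conj_eq_norm g.det, hdetG]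
    ring
  -- `det G`, `det C ∈ O'` with product `1`
  have hdet_mem : ∀ (X : Matrix (Fin n) (Fin n) k), (∀ i j, X i j ∈ O') → X.det ∈ O' := by
    intro X hX
    let X' : Matrix (Fin n) (Fin n) O' := Matrix.of fun i j => ⟨X i j, hX i j⟩
    have hX' : X = X'.map (algebraMap O' k) := by ext i j; rfl
    rw [hX', ← RingHom.mapMatrix_apply, ← RingHom.map_det]
    exact (X'.det).2
  have hGdetmem : algebraMap ℚ k (ν * dJ) ∈ O' := hdetG' ▸ hdet_mem G hGmem
  have hCdetmem : algebraMap ℚ k (ν * dJ)⁻¹ ∈ O' := by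
    have h1 : G.det * C.det = 1 := by rw [← Matrix.det_mul, hGC, Matrix.det_one]
    have h2 : C.det = (algebraMap ℚ k (ν * dJ))⁻¹ := by
      rw [← hdetG']
      exact eq_inv_of_mul_eq_one_right h1
    rw [map_inv₀, ← h2]
    exact hdet_mem C hCmem
  -- `ord_p(ν dJ) = 0`
  obtain ⟨a₁, s₁, hs₁, h₁⟩ := (mem_ofField_iff hS _).1 hGdetmem
  obtain ⟨a₂, s₂, hs₂, h₂⟩ := (mem_ofField_iff hS _).1 hCdetmem
  have hv1 := padicValRat_nonneg_of_mem (p := p) h𝔭 (mul_ne_zero hν0 hdJ0) hs₁ h₁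
  have hv2 := padicValRat_nonneg_of_mem (p := p) h𝔭 (inv_ne_zero (mul_ne_zero hν0 hdJ0)) hs₂ h₂
  rw [padicValRat.inv] at hv2
  have hv0 : padicValRat p (ν * dJ) = 0 := le_antisymm (by linarith) hv1
  rw [padicValRat.mul hν0 hdJ0] at hv0
  -- `ord_p(ν)` is even (`ν = N(det g)` is a local norm), hence so is `ord_p(dJ)`
  have hνeven : Even (padicValRat p ν) := (isLocalNormAt_iff_even_padicValRat k hin hν0).1 (isLocalNormAt_norm g.det)
  refine (isLocalNormAt_iff_even_padicValRat k hin hdJ0).2 ?_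
  obtain ⟨r, hr⟩ := hνeven
  exact ⟨-r, by linarith⟩

/-! ### The discharge of ★ `KR2013_9_diff_inert_iff_diff0` -/

/-- The determinant of a `σ`-hermitian INTEGRAL matrix is a rational integer: `σ(det T) = det ᵗT = det T`, and a `σ`-fixed algebraic
integer of the quadratic field `k` lies in `ℤ`. [folklore] -/
private theorem exists_int_eq_det {n : ℕ} {T : Matrix (Fin n) (Fin n) (𝓞 k)} (hT : IsHermitianFor (sigmaInt k : 𝓞 k →+* 𝓞 k) T) :
    ∃ d : ℤ, (d : 𝓞 k) = T.det := by
  have h1 : sigmaInt k T.det = T.det := by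
    have h := (sigmaInt k : 𝓞 k →+* 𝓞 k).map_det T
    have hmap : (sigmaInt k : 𝓞 k →+* 𝓞 k).mapMatrix T = T.transpose := by
      ext i j
      exact congrArg (fun z : 𝓞 k => (z : k)) (hT i j)
    rw [hmap, Matrix.det_transpose] at h
    exact h
  have h2 : conj ℚ k (T.det : k) = (T.det : k) := by rw [← coe_sigmaInt, h1]
  obtain ⟨q, hq⟩ := exists_rat_eq_of_conj_eq' k h2
  have hint : IsIntegral ℤ q := by
    have h : IsIntegral ℤ (algebraMap ℚ k q) := by
      rw [hq, RingOfIntegers.coe_eq_algebraMap]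
      exact RingOfIntegers.isIntegral_coe T.det
    exact (isIntegral_algebraMap_iff (algebraMap ℚ k).injective).1 h
  obtain ⟨d, hd⟩ := (IsIntegrallyClosed.isIntegral_iff (R := ℤ) (K := ℚ)).1 hint
  refine ⟨d, RingOfIntegers.ext ?_⟩
  rw [← hq, ← hd]
  simp

/-- `0` is a local norm. [folklore] -/
private theorem isLocalNormAt_zero {p : ℕ} [Fact p.Prime] : IsLocalNormAt k p 0 :=
  ⟨0, by simp⟩

/-- ★ `KR2013_9_diff_inert_iff_diff0` HOLDS. [KudlaRapoport2013, §9 after (9.2) (arXiv v2 p. 33)]: «since `V` contains a self dual lattice,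
an inert place `p` lies in `Diff(T, V)` if and only if `ord_p(det(T))` is odd» — `χ_p = (−1)^{ord_p}` at inert `p` (O'Meara 63:16, ★
`isLocalNormAt_iff_even_padicValRat`), `χ_p(det V) = 1` (★ `isLocalNormAt_det_of_isSelfDualFor`), and `det T ∈ ℤ` for `T ∈ Herm_n(O_k)`.
[cite: KudlaRapoport2013, §9 (9.2) (arXiv v2 p. 33)] -/
theorem KR2013_9_diff_inert_iff_diff0_holds : KR2013_9_diff_inert_iff_diff0 k := by
  intro n T J L hT hT0 hJ hL hLd p hin
  haveI : Fact p.Prime := ⟨hin.1⟩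
  -- `det T = d ∈ ℤ`, `det J = dJ ∈ ℚ`
  obtain ⟨d, hd⟩ := exists_int_eq_det k hT
  have hd0 : (d : ℚ) ≠ 0 := by
    intro h0
    apply hT0
    rw [← hd, show d = 0 by exact_mod_cast h0]
    simp
  have hdT : algebraMap ℚ k (d : ℚ) = (T.map (algebraMap (𝓞 k) k)).det := by
    rw [← RingHom.mapMatrix_apply, ← RingHom.map_det, ← hd]
    simp
  have hconjJ : conj ℚ k J.det = J.det := by
    have h := (conj ℚ k : k →+* k).map_det J
    have hmap : (conj ℚ k : k →+* k).mapMatrix J = J.transpose := by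
      ext i j
      exact hJ i j
    rw [hmap, Matrix.det_transpose] at h
    exact h
  obtain ⟨dJ, hdJ⟩ := exists_rat_eq_of_conj_eq' k hconjJ
  -- `p ∈ Diff₀(T) ⟺ ord_p(d)` odd
  have hdiff0 : p ∈ Sec2Defs.diff0 k T ↔ Odd (padicValInt p d) := by
    constructor
    · rintro ⟨_, d', hd', hodd⟩
      have hdd : d' = d := by
        have h := hd'.trans hd.symm
        exact_mod_cast h
      rwa [hdd] at hodd
    · exact fun h => ⟨hin, d, hd, h⟩
  rw [hdiff0]
  by_cases hJ0 : J.det = 0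
  · -- degenerate `J`: `χ_p(det J) = χ_p(0) = 1`, so `p ∈ Diff ⟺ χ_p(det T) = −1`
    have hdJ0 : dJ = 0 := by
      rw [hJ0] at hdJ
      exact (map_eq_zero _).1 hdJ
    have hiff : p ∈ diff k (T.map (algebraMap (𝓞 k) k)) J ↔ ¬ IsLocalNormAt k p (d : ℚ) := by
      constructor
      · rintro ⟨_, h⟩
        have h' := h (d : ℚ) 0 hdT (by rw [map_zero, hJ0])
        rwa [iff_true_right (isLocalNormAt_zero k)] at h'
      · intro h
        refine ⟨inferInstance, fun dT' dJ' h1 h2 => ?_⟩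
        obtain rfl : dT' = (d : ℚ) := (algebraMap ℚ k).injective (h1.trans hdT.symm)
        obtain rfl : dJ' = 0 := (algebraMap ℚ k).injective (by rw [h2, hJ0, map_zero])
        rwa [iff_true_right (isLocalNormAt_zero k)]
    rw [hiff, isLocalNormAt_iff_even_padicValRat k hin hd0, padicValRat.of_int, Int.not_even_iff_odd, Int.odd_coe_nat]
  · have hdJ0 : dJ ≠ 0 := by
      rintro rfl
      rw [map_zero] at hdJ
      exact hJ0 hdJ.symm
    have heven : Even (padicValRat p dJ) :=
      (isLocalNormAt_iff_even_padicValRat k hin hdJ0).1 (isLocalNormAt_det_of_isSelfDualFor k hJ0 hL hLd hin hdJ)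
    rw [mem_diff_iff_odd_padicValRat k hin hdT hdJ hd0 hdJ0, padicValRat.mul hd0 hdJ0, Int.odd_add, padicValRat.of_int,
      Int.odd_coe_nat]
    exact ⟨fun h => h.2 heven, fun h => ⟨fun _ => heven, fun _ => h⟩⟩

end Literature.AlgebraicGeometry.ShimuraVarieties.KudlaRapoport2013.Sec7to10EisensteinSide
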